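import Literature.NumberTheory.EllipticCurves.IwasawaAlgebra
import Mathlib.NumberTheory.Padics.RingHoms
import Mathlib.NumberTheory.Padics.ProperSpace
import Mathlib.Topology.MetricSpace.Ultra.Basic
import Mathlib.LinearAlgebra.Span.Basic
import Mathlib.RingTheory.Finiteness.Defs
import HarnessLib

/-!
# Compact Nakayama over the Iwasawa algebra `Λ = ℤ_p⟦T⟧`, separated form: a `Λ`-module `M` with
# `⋂_k (T^k M + p^k M) = 0` and `M = ⟨s⟩_Λ + T·M` for a finite `s` is generated by `s`

Topic `NumberTheory/EllipticCurves` (namespace = path; next to `IwasawaAlgebra.lean` and the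
`IwasawaAlgebra*Proofs` files). Cell `bsd-cn100`, prover seat `bsd-cn100-transfer-2` (g8).
`Proofs`-style file: theorems only (no definition, no named fact, no `sorry`, no instance).

## Statement and proof

Nakayama's lemma for compact `Λ`-modules ([Washington 1997, Lemma 13.16]: "`X` a compact
`Λ`-module, `X/TX` (or `X/𝔪X`) finitely generated ⟹ `X` finitely generated"; [NSW 2008, (5.2.18)])
is proved here WITHOUT a topology on `M`, in the form the tree's pinned Iwasawa cohomology
`Kato2004.IwasawaH1Data` supplies: `M` is **`(p, T)`-separated** — an element lying in
`T^k M + p^k M` for every `k` is `0` — and `M = ⟨s⟩_Λ + T·M` for a finite set `s`.  Conclusion: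
`⟨s⟩_Λ = M` (`span_eq_top_of_separated_of_forall_exists_sub_X_smul_mem_span`), so `M` is a finitely
generated `Λ`-module (`module_finite_of_separated_of_forall_exists_sub_X_smul_mem_span`).
Proof: iterating gives `M = ⟨s⟩ + T^k M` for all `k`; for `x ∈ M` the sets
`D_k = {c ∈ (ℤ_p^ℕ)^s : x − Σ_i (Σ_j c_{ij} T^j) s_i ∈ T^k M + p^k M}` of COEFFICIENT families are
non-empty, decreasing, and clopen in the compact product topology (membership depends only on the
`c_{ij} mod p^k`, `j < k`: `mk_eq_X_pow_mul_add_C_mul_of_norm_le`), so they share a point `c`, and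
`x − Σ_i (Σ_j c_{ij}T^j) s_i ∈ ⋂_k (T^k M + p^k M) = 0`.  The companion file
`PadicIntSeparatedFiniteProofs` is the same argument over `ℤ_p`.

## References

* L. C. Washington, *Introduction to Cyclotomic Fields*, 2nd ed., GTM 83 (1997), Lemma 13.16.
  [Washington1997]
* J. Neukirch, A. Schmidt, K. Wingberg, *Cohomology of Number Fields*, 2nd ed. (2008), (5.2.18).
  [NeukirchSchmidtWingberg2008]
-/

noncomputable section

namespace Literature.NumberTheory.EllipticCurves

variable {p : ℕ} [Fact p.Prime]

/-! ## Coefficientwise congruences in `Λ` -/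

/-- A power series whose first `k` coefficients are divisible by `p^k` lies in `T^k Λ + p^k Λ`:
`Σ_j d_j T^j = T^k·g + p^k·h`. [folklore] -/
private theorem mk_eq_X_pow_mul_add_C_mul_of_norm_le (k : ℕ) {d : ℕ → ℤ_[p]}
    (hd : ∀ j, j < k → ‖d j‖ ≤ (p : ℝ) ^ (-(k : ℤ))) :
    ∃ g h : IwasawaAlgebra p, PowerSeries.mk d =
      (PowerSeries.X : IwasawaAlgebra p) ^ k * g + PowerSeries.C (((p : ℤ_[p]) ^ k)) * h := by
  classical
  have hdiv : ∀ j, j < k → ∃ e : ℤ_[p], e * (p : ℤ_[p]) ^ k = d j := fun j hj =>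
    Ideal.mem_span_singleton'.mp ((PadicInt.norm_le_pow_iff_mem_span_pow _ _).mp (hd j hj))
  choose! e he using hdiv
  refine ⟨PowerSeries.mk fun j => d (j + k), PowerSeries.mk fun j => if j < k then e j else 0, ?_⟩
  ext j
  rw [map_add, PowerSeries.coeff_mk, PowerSeries.coeff_X_pow_mul', PowerSeries.coeff_C_mul,
    PowerSeries.coeff_mk, PowerSeries.coeff_mk]
  by_cases hj : j < k
  · rw [if_neg (not_le.mpr hj), if_pos hj, zero_add, mul_comm, he j hj]
  · rw [if_pos (not_lt.mp hj), if_neg hj, mul_zero, add_zero, Nat.sub_add_cancel (not_lt.mp hj)]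

/-- `PowerSeries.mk` is additive (coefficientwise). [folklore] -/
private theorem mk_sub (c c' : ℕ → ℤ_[p]) :
    (PowerSeries.mk c - PowerSeries.mk c' : IwasawaAlgebra p) = PowerSeries.mk (c - c') := by
  ext j
  simp only [map_sub, PowerSeries.coeff_mk, Pi.sub_apply]

variable {M : Type*} [AddCommGroup M] [Module (IwasawaAlgebra p) M]

/-- Two coefficient families congruent modulo `p^k` in the coefficients of index `< k` give
combinations congruent modulo `T^k M + p^k M`. [folklore] -/
private theorem exists_sum_mk_sub_sum_mk {ι : Type*} [Fintype ι] (v : ι → M) (k : ℕ)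
    {c c' : ι → ℕ → ℤ_[p]} (h : ∀ i, ∀ j, j < k → ‖c i j - c' i j‖ ≤ (p : ℝ) ^ (-(k : ℤ))) :
    ∃ y z : M, (PowerSeries.X : IwasawaAlgebra p) ^ k • y + PowerSeries.C ((p : ℤ_[p]) ^ k) • z =
      ∑ i, (PowerSeries.mk (c i) : IwasawaAlgebra p) • v i -
        ∑ i, (PowerSeries.mk (c' i) : IwasawaAlgebra p) • v i := by
  classical
  have hgh : ∀ i, ∃ gh : IwasawaAlgebra p × IwasawaAlgebra p,
      (PowerSeries.mk (c i) - PowerSeries.mk (c' i) : IwasawaAlgebra p) =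
        (PowerSeries.X : IwasawaAlgebra p) ^ k * gh.1 + PowerSeries.C ((p : ℤ_[p]) ^ k) * gh.2 :=
    fun i => by
      obtain ⟨g, h', hgh⟩ := mk_eq_X_pow_mul_add_C_mul_of_norm_le (p := p) k
        (d := c i - c' i) (fun j hj => by simpa only [Pi.sub_apply] using h i j hj)
      exact ⟨(g, h'), by rw [mk_sub, hgh]⟩
  choose gh hgh using hgh
  refine ⟨∑ i, (gh i).1 • v i, ∑ i, (gh i).2 • v i, ?_⟩
  rw [← Finset.sum_sub_distrib, Finset.smul_sum, Finset.smul_sum, ← Finset.sum_add_distrib]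
  refine Finset.sum_congr rfl fun i _ => ?_
  rw [← sub_smul, hgh i, add_smul, mul_smul, mul_smul]

/-- **`M = ⟨s⟩ + T·M` iterates to `M = ⟨s⟩ + T^k·M`.** [folklore] -/
private theorem exists_sub_X_pow_smul_mem_span (s : Finset M)
    (hgen : ∀ x : M, ∃ y : M,
      x - (PowerSeries.X : IwasawaAlgebra p) • y ∈ Submodule.span (IwasawaAlgebra p) (s : Set M))
    (k : ℕ) (x : M) :
    ∃ y : M, x - ((PowerSeries.X : IwasawaAlgebra p) ^ k) • y ∈
      Submodule.span (IwasawaAlgebra p) (s : Set M) := by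
  induction k generalizing x with
  | zero => exact ⟨x, by rw [pow_zero, one_smul, sub_self]; exact Submodule.zero_mem _⟩
  | succ k ih =>
    obtain ⟨y, hy⟩ := hgen x
    obtain ⟨z, hz⟩ := ih y
    refine ⟨z, ?_⟩
    have : x - ((PowerSeries.X : IwasawaAlgebra p) ^ (k + 1)) • z =
        (x - (PowerSeries.X : IwasawaAlgebra p) • y) +
          (PowerSeries.X : IwasawaAlgebra p) • (y - ((PowerSeries.X : IwasawaAlgebra p) ^ k) • z) := by
      rw [smul_sub, smul_smul, ← pow_succ']
      abel
    rw [this]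
    exact Submodule.add_mem _ hy (Submodule.smul_mem _ _ hz)

/-! ## The lemma -/

/-- **Compact Nakayama over `Λ = ℤ_p⟦T⟧`, separated form.**  Let `M` be a `Λ`-module such that an
element lying in `T^k M + p^k M` for every `k` is `0`, and let `s` be a finite set with
`M = ⟨s⟩_Λ + T·M`.  Then `⟨s⟩_Λ = M`.  (Proof by compactness of the coefficient space
`(ℤ_p^ℕ)^s`; module docstring.) [cite: Washington1997, Lemma 13.16] -/
theorem span_eq_top_of_separated_of_forall_exists_sub_X_smul_mem_span
    (hsep : ∀ x : M, (∀ k : ℕ, ∃ y z : M,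
      (PowerSeries.X : IwasawaAlgebra p) ^ k • y + PowerSeries.C ((p : ℤ_[p]) ^ k) • z = x) → x = 0)
    (s : Finset M)
    (hgen : ∀ x : M, ∃ y : M,
      x - (PowerSeries.X : IwasawaAlgebra p) • y ∈ Submodule.span (IwasawaAlgebra p) (s : Set M)) :
    Submodule.span (IwasawaAlgebra p) (s : Set M) = ⊤ := by
  classical
  refine Submodule.eq_top_iff'.mpr fun x => ?_
  let ι : Type _ := ↥s
  let v : ι → M := fun i => (i : M)
  -- the element attached to a coefficient family
  let elt : (ι → ℕ → ℤ_[p]) → M := fun c => ∑ i, (PowerSeries.mk (c i) : IwasawaAlgebra p) • v i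
  -- `D k = {c | x - elt c ∈ T^k M + p^k M}`
  let D : ℕ → Set (ι → ℕ → ℤ_[p]) := fun k =>
    {c | ∃ y z : M, (PowerSeries.X : IwasawaAlgebra p) ^ k • y +
      PowerSeries.C ((p : ℤ_[p]) ^ k) • z = x - elt c}
  -- non-empty
  have hne : ∀ k, (D k).Nonempty := fun k => by
    obtain ⟨y, hy⟩ := exists_sub_X_pow_smul_mem_span s hgen k x
    obtain ⟨f, -, hf⟩ := Submodule.mem_span_finset.mp hy
    refine ⟨fun i j => PowerSeries.coeff j (f i), y, 0, ?_⟩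
    have hmk : ∀ i : ι, (PowerSeries.mk fun j => PowerSeries.coeff j (f i) : IwasawaAlgebra p) = f i :=
      fun i => PowerSeries.ext fun j => PowerSeries.coeff_mk _ _
    have hsum : elt (fun i j => PowerSeries.coeff j (f i)) = ∑ a ∈ s, f a • a := by
      simp only [elt, hmk]
      exact Finset.sum_coe_sort s (fun a => f a • a)
    rw [smul_zero, add_zero, hsum, hf, sub_sub_cancel]
  -- decreasing
  have hmono : ∀ k, D (k + 1) ⊆ D k := fun k c ⟨y, z, hyz⟩ =>
    ⟨(PowerSeries.X : IwasawaAlgebra p) • y, PowerSeries.C (p : ℤ_[p]) • z, by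
      rw [smul_smul, ← pow_succ, smul_smul, ← map_mul, ← pow_succ, hyz]⟩
  -- closed: membership depends only on the coefficients of index `< k` modulo `p^k`
  have hclosed : ∀ k, IsClosed (D k) := fun k => by
    rw [← isOpen_compl_iff, isOpen_iff_forall_mem_open]
    intro c hc
    refine ⟨{c' | ∀ i, ∀ j, j < k → ‖c' i j - c i j‖ ≤ (p : ℝ) ^ (-(k : ℤ))},
      fun c' hc' hD => hc ?_, ?_, fun i j _ => by simp⟩
    · obtain ⟨y, z, hyz⟩ := hD
      obtain ⟨y', z', hyz'⟩ := exists_sum_mk_sub_sum_mk v k (c := c') (c' := c) hc'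
      refine ⟨y + y', z + z', ?_⟩
      rw [smul_add, smul_add, add_add_add_comm, hyz, hyz']
      abel
    · have : {c' : ι → ℕ → ℤ_[p] | ∀ i, ∀ j, j < k → ‖c' i j - c i j‖ ≤ (p : ℝ) ^ (-(k : ℤ))} =
          ⋂ i, ⋂ j ∈ Finset.range k, (fun c' : ι → ℕ → ℤ_[p] => c' i j) ⁻¹'
            Metric.closedBall (c i j) ((p : ℝ) ^ (-(k : ℤ))) := by
        ext c'
        simp only [Set.mem_setOf_eq, Set.mem_iInter, Set.mem_preimage, Metric.mem_closedBall,
          dist_eq_norm, Finset.mem_range]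
      rw [this]
      refine isOpen_iInter_of_finite fun i => Set.Finite.isOpen_biInter (Finset.finite_toSet _)
        fun j _ => ?_
      exact (IsUltrametricDist.isOpen_closedBall (c i j) (zpow_ne_zero _ (by exact_mod_cast
        (Fact.out : p.Prime).ne_zero))).preimage ((continuous_apply j).comp (continuous_apply i))
  -- compactness of the coefficient space
  obtain ⟨c, hc⟩ := IsCompact.nonempty_iInter_of_sequence_nonempty_isCompact_isClosed D hmono hne
    (isCompact_univ.of_isClosed_subset (hclosed 0) (Set.subset_univ _)) hclosed
  have hx : x - elt c = 0 := hsep _ fun k => by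
    obtain ⟨y, z, hyz⟩ := Set.mem_iInter.mp hc k
    exact ⟨y, z, hyz⟩
  rw [sub_eq_zero] at hx
  rw [hx]
  exact Submodule.sum_mem _ fun i _ => Submodule.smul_mem _ _ (Submodule.subset_span i.2)

/-- **Finite generation over `Λ` from `(p, T)`-separatedness and `M = ⟨s⟩_Λ + T·M`.**
[cite: Washington1997, Lemma 13.16] -/
theorem module_finite_of_separated_of_forall_exists_sub_X_smul_mem_span
    (hsep : ∀ x : M, (∀ k : ℕ, ∃ y z : M,
      (PowerSeries.X : IwasawaAlgebra p) ^ k • y + PowerSeries.C ((p : ℤ_[p]) ^ k) • z = x) → x = 0)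
    (s : Finset M)
    (hgen : ∀ x : M, ∃ y : M,
      x - (PowerSeries.X : IwasawaAlgebra p) • y ∈ Submodule.span (IwasawaAlgebra p) (s : Set M)) :
    Module.Finite (IwasawaAlgebra p) M :=
  ⟨⟨s, span_eq_top_of_separated_of_forall_exists_sub_X_smul_mem_span hsep s hgen⟩⟩

end Literature.NumberTheory.EllipticCurves

end
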